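import Literature.RingTheory.TwoVariableSeries.NoCancellation
import HarnessLib

/-!
# Cutkosky's Lemma 3.1, towards (C4): extremal terms and exact powers of a variable in `F[[X,Y]]`

`Literature/Barriers/ResolutionOfSingularities/LocalMonomializationFailsLemmaSeries.lean` — pure
power-series lemmas used by the proof that `A → B_i` is not monomial (conclusion (C4) of
`Literature.Barriers.ResolutionOfSingularities.Cutkosky.CutkoskyLemma31`, Cutkosky, Math. Ann. 362
(2015), Lemma 3.1):

* **exact powers of a variable** (`X_k ᵃ ∣ f`, `X_k ᵃ⁺¹ ∤ f`) are additive on products and powers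
  and unique — the elementary substitute for the `X_k`-adic valuation;
* **extremal terms**: in a finite sum `Σ X_k^{N i} gᵢ` with the `gᵢ` not divisible by `X_k` and
  `N` injective, the exact power of `X_k` dividing the sum is `min N` (`X_pow_dvd_sum_and_not_dvd`);
  the one-variable analogue (`powerSeries_sum_ne_zero`);
* **`Y`-adic no cancellation** (`not_X_one_pow_dvd_aeval`): if `q₀ = Y^{n₀} r₀`, `q₁ = Y^{n₁} r₁`
  with `rⱼ(X, 0) = X^{eⱼ}·unit` and `n₀e₁ ≠ n₁e₀`, then for every exponent `(j,k)` occurring in a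
  polynomial `h` the power `Y^{n₀j+n₁k+1}` does not divide `h(q₀,q₁)`;
* in characteristic `p`, `p`-th powers have no degree-one component.

Everything here is [folklore].
-/

noncomputable section

namespace Literature.Barriers.ResolutionOfSingularities

namespace Cutkosky

open Literature.RingTheory.TwoVariableSeries _root_.MvPowerSeries

universe u

variable {F : Type u} [Field F]

/-! ## Divisibility by a variable -/

/-- `X_k` is prime: if it divides a product it divides a factor. [folklore] -/
theorem X_dvd_or_dvd_of_dvd_mul (k : Fin 2) {f g : MvPowerSeries (Fin 2) F}
    (h : (X k : MvPowerSeries (Fin 2) F) ∣ f * g) :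
    (X k : MvPowerSeries (Fin 2) F) ∣ f ∨ (X k : MvPowerSeries (Fin 2) F) ∣ g := by
  rw [← killVar_eq_zero_iff, map_mul, mul_eq_zero] at h
  rcases h with h | h
  · exact Or.inl ((killVar_eq_zero_iff k f).mp h)
  · exact Or.inr ((killVar_eq_zero_iff k g).mp h)

/-- `X_k` dividing a power divides the base. [folklore] -/
theorem X_dvd_of_dvd_pow (k : Fin 2) {f : MvPowerSeries (Fin 2) F} {n : ℕ}
    (h : (X k : MvPowerSeries (Fin 2) F) ∣ f ^ n) : (X k : MvPowerSeries (Fin 2) F) ∣ f := by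
  rw [← killVar_eq_zero_iff, map_pow] at h
  exact (killVar_eq_zero_iff k f).mp (eq_zero_of_pow_eq_zero h)

/-- A series with nonzero restriction to the axis `X_k = 0` is not divisible by `X_k`. [folklore] -/
theorem not_X_dvd_of_killVar_ne_zero (k : Fin 2) {f : MvPowerSeries (Fin 2) F} (h : killVar k f ≠ 0) :
    ¬ (X k : MvPowerSeries (Fin 2) F) ∣ f := fun hd =>
  h ((killVar_eq_zero_iff k f).mpr hd)

/-- A unit is not divisible by a variable. [folklore] -/
theorem not_X_dvd_of_constantCoeff_ne_zero (k : Fin 2) {f : MvPowerSeries (Fin 2) F}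
    (h : constantCoeff f ≠ 0) : ¬ (X k : MvPowerSeries (Fin 2) F) ∣ f :=
  not_X_dvd_of_killVar_ne_zero k fun h0 => h (by rw [← constantCoeff_killVar k, h0, map_zero])

/-! ## Exact powers of a variable -/

/-- **Exact powers multiply**: if `X_kᵃ ∥ f` and `X_kᵇ ∥ g` then `X_k^{a+b} ∥ fg`. [folklore] -/
theorem X_pow_dvd_mul_and_not_dvd (k : Fin 2) {f g : MvPowerSeries (Fin 2) F} {a b : ℕ}
    (hf : (X k : MvPowerSeries (Fin 2) F) ^ a ∣ f) (hf' : ¬ (X k : MvPowerSeries (Fin 2) F) ^ (a + 1) ∣ f)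
    (hg : (X k : MvPowerSeries (Fin 2) F) ^ b ∣ g) (hg' : ¬ (X k : MvPowerSeries (Fin 2) F) ^ (b + 1) ∣ g) :
    (X k : MvPowerSeries (Fin 2) F) ^ (a + b) ∣ f * g ∧
      ¬ (X k : MvPowerSeries (Fin 2) F) ^ (a + b + 1) ∣ f * g := by
  haveI := isDomain_mvPowerSeries (F := F) (Fin 2)
  obtain ⟨f', rfl⟩ := hf
  obtain ⟨g', rfl⟩ := hg
  have hf'' : ¬ (X k : MvPowerSeries (Fin 2) F) ∣ f' := fun ⟨q, hq⟩ =>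
    hf' ⟨q, by rw [hq, pow_succ, mul_assoc]⟩
  have hg'' : ¬ (X k : MvPowerSeries (Fin 2) F) ∣ g' := fun ⟨q, hq⟩ =>
    hg' ⟨q, by rw [hq, pow_succ, mul_assoc]⟩
  refine ⟨⟨f' * g', by rw [pow_add]; ring⟩, ?_⟩
  rintro ⟨q, hq⟩
  have h1 : (X k : MvPowerSeries (Fin 2) F) ^ (a + b) * (f' * g') = X k ^ (a + b) * (X k * q) :=
    calc (X k : MvPowerSeries (Fin 2) F) ^ (a + b) * (f' * g') = X k ^ a * f' * (X k ^ b * g') := by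
          rw [pow_add]; ring
      _ = X k ^ (a + b + 1) * q := hq
      _ = X k ^ (a + b) * (X k * q) := by rw [pow_succ]; ring
  have h2 := mul_left_cancel₀ (pow_ne_zero _ (X_ne_zero' k)) h1
  rcases X_dvd_or_dvd_of_dvd_mul k ⟨q, h2⟩ with h | h
  · exact hf'' h
  · exact hg'' h

/-- **Exact powers of powers**: if `X_kᵃ ∥ f` then `X_k^{a n} ∥ fⁿ`. [folklore] -/
theorem X_pow_dvd_pow_and_not_dvd (k : Fin 2) {f : MvPowerSeries (Fin 2) F} {a : ℕ}
    (hf : (X k : MvPowerSeries (Fin 2) F) ^ a ∣ f) (hf' : ¬ (X k : MvPowerSeries (Fin 2) F) ^ (a + 1) ∣ f)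
    (n : ℕ) :
    (X k : MvPowerSeries (Fin 2) F) ^ (a * n) ∣ f ^ n ∧
      ¬ (X k : MvPowerSeries (Fin 2) F) ^ (a * n + 1) ∣ f ^ n := by
  induction n with
  | zero =>
    refine ⟨by simp, ?_⟩
    rw [mul_zero, zero_add, pow_one, pow_zero]
    exact not_X_dvd_of_constantCoeff_ne_zero k (by rw [constantCoeff_one]; exact one_ne_zero)
  | succ n ih =>
    have h := X_pow_dvd_mul_and_not_dvd k ih.1 ih.2 hf hf'
    rw [← pow_succ] at h
    rw [Nat.mul_succ]
    exact h

/-- **Exact powers are unique.** [folklore] -/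
theorem eq_of_X_pow_dvd_and_not_dvd (k : Fin 2) {f : MvPowerSeries (Fin 2) F} {a b : ℕ}
    (ha : (X k : MvPowerSeries (Fin 2) F) ^ a ∣ f) (ha' : ¬ (X k : MvPowerSeries (Fin 2) F) ^ (a + 1) ∣ f)
    (hb : (X k : MvPowerSeries (Fin 2) F) ^ b ∣ f) (hb' : ¬ (X k : MvPowerSeries (Fin 2) F) ^ (b + 1) ∣ f) :
    a = b := by
  by_contra hne
  rcases Nat.lt_or_gt_of_ne hne with h | h
  · exact ha' ((pow_dvd_pow _ (Nat.succ_le_of_lt h)).trans hb)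
  · exact hb' ((pow_dvd_pow _ (Nat.succ_le_of_lt h)).trans ha)

/-- A unit has exact `X_k`-power `0`. [folklore] -/
theorem X_pow_zero_dvd_and_not_dvd_of_constantCoeff_ne_zero (k : Fin 2) {f : MvPowerSeries (Fin 2) F}
    (h : constantCoeff f ≠ 0) :
    (X k : MvPowerSeries (Fin 2) F) ^ 0 ∣ f ∧ ¬ (X k : MvPowerSeries (Fin 2) F) ^ (0 + 1) ∣ f :=
  ⟨by rw [pow_zero]; exact one_dvd _, by rw [zero_add, pow_one]; exact not_X_dvd_of_constantCoeff_ne_zero k h⟩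

/-- A series not divisible by `X_k` has exact `X_k`-power `0`. [folklore] -/
theorem X_pow_zero_dvd_and_not_dvd_of_not_dvd (k : Fin 2) {f : MvPowerSeries (Fin 2) F}
    (h : ¬ (X k : MvPowerSeries (Fin 2) F) ∣ f) :
    (X k : MvPowerSeries (Fin 2) F) ^ 0 ∣ f ∧ ¬ (X k : MvPowerSeries (Fin 2) F) ^ (0 + 1) ∣ f :=
  ⟨by rw [pow_zero]; exact one_dvd _, by rwa [zero_add, pow_one]⟩

/-- `C c · X_k` has exact `X_k`-power `1` (`c ≠ 0`). [folklore] -/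
theorem X_pow_one_dvd_C_mul_X_and_not_dvd (k : Fin 2) {c : F} (hc : c ≠ 0) :
    (X k : MvPowerSeries (Fin 2) F) ^ 1 ∣ C c * X k ∧ ¬ (X k : MvPowerSeries (Fin 2) F) ^ (1 + 1) ∣ C c * X k := by
  have h := X_pow_dvd_mul_and_not_dvd k (a := 0) (b := 1) (f := C c) (g := X k)
    (by rw [pow_zero]; exact one_dvd _)
    (by rw [zero_add, pow_one]; exact not_X_dvd_of_constantCoeff_ne_zero k (by rwa [constantCoeff_C]))
    (by rw [pow_one])
    (by
      rw [pow_succ, pow_one]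
      rintro ⟨q, hq⟩
      haveI := isDomain_mvPowerSeries (F := F) (Fin 2)
      have h1 : (X k : MvPowerSeries (Fin 2) F) * 1 = X k * (X k * q) := by rw [mul_one, ← mul_assoc]; exact hq
      have h2 := mul_left_cancel₀ (X_ne_zero' k) h1
      exact not_X_dvd_of_constantCoeff_ne_zero k (f := 1) (by rw [constantCoeff_one]; exact one_ne_zero) ⟨q, h2⟩)
  rwa [zero_add] at h

/-! ## Extremal terms -/

/-- **Extremal term of a finite sum** (two variables): if the `gᵢ` (`i ∈ s`) are not divisible by
`X_k` and `N` is injective on `s`, then for `i₀ ∈ s` minimising `N` the exact power of `X_k`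
dividing `Σ_{i∈s} X_k^{N i} gᵢ` is `N i₀`. [folklore] -/
theorem X_pow_dvd_sum_and_not_dvd {ι : Type*} (s : Finset ι) (N : ι → ℕ) (g : ι → MvPowerSeries (Fin 2) F)
    (k : Fin 2) (hg : ∀ i ∈ s, ¬ (X k : MvPowerSeries (Fin 2) F) ∣ g i) (hN : Set.InjOn N s)
    {i₀ : ι} (hi₀ : i₀ ∈ s) (hmin : ∀ i ∈ s, N i₀ ≤ N i) :
    (X k : MvPowerSeries (Fin 2) F) ^ N i₀ ∣ ∑ i ∈ s, X k ^ N i * g i ∧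
      ¬ (X k : MvPowerSeries (Fin 2) F) ^ (N i₀ + 1) ∣ ∑ i ∈ s, X k ^ N i * g i := by
  classical
  haveI := isDomain_mvPowerSeries (F := F) (Fin 2)
  constructor
  · exact Finset.dvd_sum fun i hi => (pow_dvd_pow _ (hmin i hi)).mul_right _
  · intro hdvd
    rw [← Finset.add_sum_erase s _ hi₀] at hdvd
    have hrest : (X k : MvPowerSeries (Fin 2) F) ^ (N i₀ + 1) ∣ ∑ i ∈ s.erase i₀, X k ^ N i * g i := by
      refine Finset.dvd_sum fun i hi => ?_
      obtain ⟨hne, his⟩ := Finset.mem_erase.mp hi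
      have hlt : N i₀ < N i := lt_of_le_of_ne (hmin i his) fun h => hne (hN his hi₀ h.symm)
      exact (pow_dvd_pow _ (Nat.succ_le_of_lt hlt)).mul_right _
    have h0 : (X k : MvPowerSeries (Fin 2) F) ^ (N i₀ + 1) ∣ X k ^ N i₀ * g i₀ :=
      (dvd_add_left hrest).mp hdvd
    obtain ⟨q, hq⟩ := h0
    have h1 : (X k : MvPowerSeries (Fin 2) F) ^ N i₀ * g i₀ = X k ^ N i₀ * (X k * q) := by
      rw [hq, pow_succ, mul_assoc]
    exact hg i₀ hi₀ ⟨q, mul_left_cancel₀ (pow_ne_zero _ (X_ne_zero' k)) h1⟩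

/-- **Extremal term of a finite sum** (one variable): `Σ_{i∈s} cᵢ t^{E i} ρᵢ ≠ 0` if `s ≠ ∅`, the
`cᵢ` are nonzero, the `ρᵢ` are units and `E` is injective on `s`. [folklore] -/
theorem powerSeries_sum_ne_zero {ι : Type*} (s : Finset ι) (E : ι → ℕ) (c : ι → F) (ρ : ι → PowerSeries F)
    (hc : ∀ i ∈ s, c i ≠ 0) (hρ : ∀ i ∈ s, PowerSeries.constantCoeff (ρ i) ≠ 0) (hE : Set.InjOn E s)
    (hs : s.Nonempty) :
    ∑ i ∈ s, PowerSeries.C (c i) * PowerSeries.X ^ E i * ρ i ≠ 0 := by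
  classical
  obtain ⟨i₀, hi₀, hmin⟩ := Finset.exists_min_image s E hs
  intro hzero
  have h := congrArg (PowerSeries.coeff (E i₀)) hzero
  rw [map_zero, map_sum, Finset.sum_eq_single i₀] at h
  · rw [mul_assoc, PowerSeries.coeff_C_mul, PowerSeries.coeff_X_pow_mul', if_pos le_rfl, Nat.sub_self,
      PowerSeries.coeff_zero_eq_constantCoeff_apply] at h
    rcases mul_eq_zero.mp h with h | h
    · exact hc i₀ hi₀ h
    · exact hρ i₀ hi₀ h
  · intro i hi hne
    have hlt : E i₀ < E i := lt_of_le_of_ne (hmin i hi) fun h => hne (hE hi hi₀ h.symm)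
    rw [mul_assoc, PowerSeries.coeff_C_mul, PowerSeries.coeff_X_pow_mul', if_neg (not_le.mpr hlt), mul_zero]
  · intro h
    exact (h hi₀).elim

/-! ## `Y`-adic no cancellation -/

/-- Exponents on a line of one weight with equal value of an independent second weight coincide.
[folklore] -/
theorem finsupp_eq_of_weights_eq {n₀ n₁ e₀ e₁ : ℕ} (hdet : n₀ * e₁ ≠ n₁ * e₀) {a b : Fin 2 →₀ ℕ}
    (h1 : n₀ * a 0 + n₁ * a 1 = n₀ * b 0 + n₁ * b 1) (h2 : e₀ * a 0 + e₁ * a 1 = e₀ * b 0 + e₁ * b 1) :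
    a = b := by
  have h1' : (n₀ : ℤ) * a 0 + n₁ * a 1 = n₀ * b 0 + n₁ * b 1 := by exact_mod_cast h1
  have h2' : (e₀ : ℤ) * a 0 + e₁ * a 1 = e₀ * b 0 + e₁ * b 1 := by exact_mod_cast h2
  have hd : ((n₀ : ℤ) * e₁ - n₁ * e₀) ≠ 0 := by
    intro h
    apply hdet
    have : (n₀ : ℤ) * e₁ = n₁ * e₀ := by linear_combination h
    exact_mod_cast this
  have ha0 : a 0 = b 0 := by
    have h : ((n₀ : ℤ) * e₁ - n₁ * e₀) * ((a 0 : ℤ) - b 0) = 0 := by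
      linear_combination (e₁ : ℤ) * h1' - (n₁ : ℤ) * h2'
    rcases mul_eq_zero.mp h with h | h
    · exact (hd h).elim
    · exact_mod_cast (sub_eq_zero.mp h)
  have ha1 : a 1 = b 1 := by
    rw [ha0] at h1 h2
    have h1'' : n₁ * a 1 = n₁ * b 1 := by omega
    have h2'' : e₁ * a 1 = e₁ * b 1 := by omega
    by_cases hn : n₁ = 0
    · by_cases he : e₁ = 0
      · exfalso; apply hdet; rw [hn, he, mul_zero, zero_mul]
      · exact Nat.eq_of_mul_eq_mul_left (Nat.pos_of_ne_zero he) h2''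
    · exact Nat.eq_of_mul_eq_mul_left (Nat.pos_of_ne_zero hn) h1''
  exact finsupp_fin2_ext ha0 ha1

/-- **`Y`-adic no cancellation.** Let `q₀ = Y^{n₀} r₀`, `q₁ = Y^{n₁} r₁` where the restrictions
`rⱼ(X, 0)` equal `X^{eⱼ}` times a unit, with `n₀ e₁ ≠ n₁ e₀`. Then for every exponent `e = (j,k)`
occurring in a polynomial `h`, `Y^{n₀ j + n₁ k + 1}` does not divide `h(q₀, q₁)`: the terms of
minimal `Y`-weight restrict, on `Y = 0`, to multiples of pairwise distinct powers of `X`.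
[folklore] -/
theorem not_X_one_pow_dvd_aeval {n₀ n₁ e₀ e₁ : ℕ} (hdet : n₀ * e₁ ≠ n₁ * e₀)
    {r₀ r₁ : MvPowerSeries (Fin 2) F} {ρ₀ ρ₁ : PowerSeries F}
    (hρ₀ : PowerSeries.constantCoeff ρ₀ ≠ 0) (hρ₁ : PowerSeries.constantCoeff ρ₁ ≠ 0)
    (hr₀ : killVar 1 r₀ = PowerSeries.X ^ e₀ * ρ₀) (hr₁ : killVar 1 r₁ = PowerSeries.X ^ e₁ * ρ₁)
    (q : Fin 2 → MvPowerSeries (Fin 2) F) (hq₀ : q 0 = X 1 ^ n₀ * r₀) (hq₁ : q 1 = X 1 ^ n₁ * r₁)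
    (h : MvPolynomial (Fin 2) F) {e : Fin 2 →₀ ℕ} (he : e ∈ h.support) :
    ¬ (X 1 : MvPowerSeries (Fin 2) F) ^ (n₀ * e 0 + n₁ * e 1 + 1) ∣ MvPolynomial.aeval q h := by
  classical
  haveI := isDomain_mvPowerSeries (F := F) (Fin 2)
  -- the `Y`-weight and its minimum over the support
  set W : (Fin 2 →₀ ℕ) → ℕ := fun a => n₀ * a 0 + n₁ * a 1 with hW
  have hne : h.support.Nonempty := ⟨e, he⟩
  obtain ⟨a₀, ha₀, hmin⟩ := Finset.exists_min_image h.support W hne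
  set m := W a₀ with hm
  -- it suffices to treat the minimal weight
  suffices hsuff : ¬ (X 1 : MvPowerSeries (Fin 2) F) ^ (m + 1) ∣ MvPolynomial.aeval q h by
    intro hdvd
    exact hsuff ((pow_dvd_pow _ (Nat.succ_le_succ (hmin e he))).trans hdvd)
  -- expansion of `h(q₀,q₁)`
  have hterm : ∀ a : Fin 2 →₀ ℕ, MvPolynomial.aeval q (MvPolynomial.monomial a (MvPolynomial.coeff a h)) =
      X 1 ^ W a * (C (MvPolynomial.coeff a h) * (r₀ ^ a 0 * r₁ ^ a 1)) := by
    intro a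
    rw [aeval_monomial_fin2, hq₀, hq₁, mul_pow, mul_pow, ← pow_mul, ← pow_mul, hW]
    simp only
    rw [pow_add]
    ring
  have hexp : MvPolynomial.aeval q h = ∑ a ∈ h.support, X 1 ^ W a * (C (MvPolynomial.coeff a h) * (r₀ ^ a 0 * r₁ ^ a 1)) := by
    conv_lhs => rw [h.as_sum, map_sum]
    exact Finset.sum_congr rfl fun a _ => hterm a
  -- split off the terms of minimal weight
  set S := h.support.filter fun a => W a = m with hS
  set P : MvPowerSeries (Fin 2) F := ∑ a ∈ S, C (MvPolynomial.coeff a h) * (r₀ ^ a 0 * r₁ ^ a 1) with hP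
  have hsplit : MvPolynomial.aeval q h = X 1 ^ m * P +
      ∑ a ∈ h.support.filter (fun a => W a ≠ m), X 1 ^ W a * (C (MvPolynomial.coeff a h) * (r₀ ^ a 0 * r₁ ^ a 1)) := by
    rw [hexp, ← Finset.sum_filter_add_sum_filter_not h.support (fun a => W a = m), hP, Finset.mul_sum]
    congr 1
    refine Finset.sum_congr rfl fun a ha => ?_
    rw [(Finset.mem_filter.mp ha).2]
  have hrest : (X 1 : MvPowerSeries (Fin 2) F) ^ (m + 1) ∣
      ∑ a ∈ h.support.filter (fun a => W a ≠ m), X 1 ^ W a * (C (MvPolynomial.coeff a h) * (r₀ ^ a 0 * r₁ ^ a 1)) := by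
    refine Finset.dvd_sum fun a ha => ?_
    obtain ⟨has, hane⟩ := Finset.mem_filter.mp ha
    have hlt : m < W a := lt_of_le_of_ne (hmin a has) (Ne.symm hane)
    exact (pow_dvd_pow _ (Nat.succ_le_of_lt hlt)).mul_right _
  -- the restriction of `P` to `Y = 0` is nonzero
  have hPk : killVar 1 P ≠ 0 := by
    have hk : killVar 1 P = ∑ a ∈ S, PowerSeries.C (MvPolynomial.coeff a h) * PowerSeries.X ^ (e₀ * a 0 + e₁ * a 1) *
        (ρ₀ ^ a 0 * ρ₁ ^ a 1) := by
      rw [hP, map_sum]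
      refine Finset.sum_congr rfl fun a _ => ?_
      rw [map_mul, map_mul, map_pow, map_pow, killVar_C, hr₀, hr₁, mul_pow, mul_pow, ← pow_mul, ← pow_mul, pow_add]
      ring
    rw [hk]
    refine powerSeries_sum_ne_zero S _ _ _ (fun a ha => MvPolynomial.mem_support_iff.mp (Finset.mem_filter.mp ha).1)
      (fun a _ => ?_) (fun a ha b hb hab => ?_) ⟨a₀, Finset.mem_filter.mpr ⟨ha₀, rfl⟩⟩
    · rw [map_mul, map_pow, map_pow]
      exact mul_ne_zero (pow_ne_zero _ hρ₀) (pow_ne_zero _ hρ₁)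
    · have ha' := (Finset.mem_filter.mp (Finset.mem_coe.mp ha)).2
      have hb' := (Finset.mem_filter.mp (Finset.mem_coe.mp hb)).2
      exact finsupp_eq_of_weights_eq hdet (ha'.trans hb'.symm) hab
  -- conclusion
  intro hdvd
  rw [hsplit] at hdvd
  have h0 : (X 1 : MvPowerSeries (Fin 2) F) ^ (m + 1) ∣ X 1 ^ m * P := (dvd_add_left hrest).mp hdvd
  obtain ⟨t, ht⟩ := h0
  have h1 : (X 1 : MvPowerSeries (Fin 2) F) ^ m * P = X 1 ^ m * (X 1 * t) := by rw [ht, pow_succ, mul_assoc]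
  have h2 : (X 1 : MvPowerSeries (Fin 2) F) ∣ P := ⟨t, mul_left_cancel₀ (pow_ne_zero _ (X_ne_zero' 1)) h1⟩
  exact hPk ((killVar_eq_zero_iff 1 P).mpr h2)

/-! ## Degree-one components -/

/-- An exponent of degree one on `Fin 2` is `(1,0)` or `(0,1)`. [folklore] -/
theorem eq_single_of_degree_eq_one {m : Fin 2 →₀ ℕ} (hm : Finsupp.degree m = 1) :
    m = Finsupp.single 0 1 ∨ m = Finsupp.single 1 1 := by
  rw [degree_fin2] at hm
  rcases Nat.eq_zero_or_pos (m 0) with h0 | h0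
  · right
    exact finsupp_fin2_ext (by simp [h0]) (by simp; omega)
  · left
    exact finsupp_fin2_ext (by simp; omega) (by simp; omega)

/-- **In characteristic `p`, a `p`-th power has no degree-one component.** [folklore] -/
theorem homogeneousComponent_one_pow_char (p : ℕ) [Fact p.Prime] [CharP F p] (f : MvPowerSeries (Fin 2) F) :
    homogeneousComponent 1 (f ^ p) = 0 := by
  haveI := charP_mvPowerSeries (R := F) (Fin 2) p
  ext m
  rw [coeff_homogeneousComponent, map_zero]
  split_ifs with hm
  · rcases eq_single_of_degree_eq_one hm with rfl | rfl
    · exact coeff_single_one_pow_eq_zero p 0 f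
    · exact coeff_single_one_pow_eq_zero p 1 f
  · rfl

/-- A nonzero linear form not divisible by `X_k` has a nonzero `X_k`-coefficient... stated as: a
homogeneous form of degree one with both degree-one coefficients zero vanishes. [folklore] -/
theorem eq_zero_of_isHomogeneous_one {ℓ : MvPowerSeries (Fin 2) F} (hℓ : IsHomogeneous ℓ 1)
    (h0 : coeff (Finsupp.single 0 1) ℓ = 0) (h1 : coeff (Finsupp.single 1 1) ℓ = 0) : ℓ = 0 := by
  ext m
  rw [map_zero]
  by_cases hm : Finsupp.degree m = 1
  · rcases eq_single_of_degree_eq_one hm with rfl | rfl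
    · exact h0
    · exact h1
  · exact hℓ.coeff_eq_zero hm

/-- The degree-one component of `X_k · f` is `f(0) · X_k`. [folklore] -/
theorem homogeneousComponent_one_X_mul (k : Fin 2) (f : MvPowerSeries (Fin 2) F) :
    homogeneousComponent 1 (X k * f) = C (constantCoeff f) * X k := by
  rw [mul_comm, homogeneousComponent_one_mul_of_constantCoeff_eq_zero f (X k) (constantCoeff_X k)]
  congr 1
  exact ((isHomogeneous_iff_eq_homogeneousComponent).mp (isHomogeneous_X k)).symm

/-- The degree-one component of `X_kⁿ · f` vanishes for `n ≥ 2`. [folklore] -/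
theorem homogeneousComponent_one_X_pow_mul {k : Fin 2} {n : ℕ} (hn : 2 ≤ n) (f : MvPowerSeries (Fin 2) F) :
    homogeneousComponent 1 (X k ^ n * f) = 0 := by
  apply homogeneousComponent_of_lt_order_eq_zero
  have h1 : ((n : ℕ) : ℕ∞) ≤ ((X k : MvPowerSeries (Fin 2) F) ^ n).order :=
    le_order_pow_of_constantCoeff_eq_zero n (constantCoeff_X k)
  have h2 : ((X k : MvPowerSeries (Fin 2) F) ^ n).order ≤ (X k ^ n * f).order := le_trans le_self_add le_order_mul
  have h3 : ((1 : ℕ) : ℕ∞) < n := by exact_mod_cast hn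
  exact lt_of_lt_of_le h3 (h1.trans h2)

end Cutkosky

end Literature.Barriers.ResolutionOfSingularities
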